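import Mathlib

/-!
# Lemma A4.3.2 — cross products of algebraic classes: the bookkeeping

Blind cell pub-hodge-repro2, seat p6 (sub-claim A2 annex, Tier 4). Imports Mathlib only.

THE PROSE (route/T4-A2-p6.md, Lemma A4.3.2 [P]): «Let X, Y be smooth projective varieties, V ⊂ X and W ⊂ Y closed
subvarieties of codimensions k, l. Then cl^{X×Y}(V × W) = cl^X(V) × cl^Y(W) in H^{2k+2l}(X × Y). Hence
a × b ∈ Alg^{2k+2l}(X × Y) for a ∈ Alg^{2k}(X), b ∈ Alg^{2l}(Y). Proof. V × W is a closed subvariety of X × Y of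
codimension k + l. By (F2), cl_{X×Y}(V × W) = cl_X(V) × cl_Y(W) in homology. By Bredon Thm. 5.4 with a = μ_X (of even
degree 2 dim X, so the sign is +1): (cl^X(V) × cl^Y(W)) ∩ (μ_X × μ_Y) = (cl^X(V) ∩ μ_X) × (cl^Y(W) ∩ μ_Y)
= cl_X(V) × cl_Y(W). Since μ_{X×Y} = μ_X × μ_Y [A2.0(b)], cl^{X×Y}(V × W) ∩ μ_{X×Y} = cl_{X×Y}(V × W)
= (cl^X(V) × cl^Y(W)) ∩ μ_{X×Y}, and the injectivity of ∩μ_{X×Y} gives the identity. The last claim follows by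
bilinearity of ×.»

HONEST SCOPE (as in rows 6 / 7 of route/LEAN-ANNEX-p6.md): the cohomology and homology groups are modules over the
coefficient ring, the Poincaré-duality maps `∩ μ` are linear maps taken as DATA together with the two printed
inputs — Bredon Thm. 5.4 in its even-degree form with μ_{X×Y} = μ_X × μ_Y (`hcap`) and the injectivity of `∩ μ_{X×Y}`
(`hinj`) — and Fulton's (F2) is a hypothesis on the three homology classes. Nothing geometric is constructed; the
file proves exactly the two displayed deductions.

WHAT IS PROVED HERE:
* **`clC_prod`** — the identity cl^{X×Y}(V × W) = cl^X(V) × cl^Y(W): from `∩ μ_{X×Y}` injective, (F2) and `hcap`.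
* **`cross_mem_span`** — «the last claim follows by bilinearity of ×»: if `a` lies in the span of the classes of
  subvarieties of X and `b` in the span of those of Y, then `a × b` lies in the span of the classes of subvarieties
  of X × Y (given the identity for the generators); `cross_mem_span_of_forall` — the form used in (A4.3.3)
  (Alg^*(X × Y) any submodule containing the cross products of generators).
§8(d) declaration: uses an L-value-free non-vanishing device: NO.
-/

namespace Summit.Ventures.HodgeRepro2.A2CrossProduct

variable {R : Type*} [CommRing R]
  {HX HY HXY : Type*} [AddCommGroup HX] [AddCommGroup HY] [AddCommGroup HXY]
  [Module R HX] [Module R HY] [Module R HXY]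
  {GX GY GXY : Type*} [AddCommGroup GX] [AddCommGroup GY] [AddCommGroup GXY]
  [Module R GX] [Module R GY] [Module R GXY]

/-- **Lemma A4.3.2, the identity**: with `capX = ∩ μ_X`, `capY = ∩ μ_Y`, `capXY = ∩ μ_{X×Y}` (cohomology → homology),
`crossC` / `crossH` the cross products on cohomology / homology, Bredon 5.4 + μ_{X×Y} = μ_X × μ_Y as
`hcap : (a × b) ∩ μ_{X×Y} = (a ∩ μ_X) × (b ∩ μ_Y)`, and `∩ μ_{X×Y}` injective: if `cV`, `cW`, `cVW` are the
cohomological classes (their caps are the homology classes `hV`, `hW`, `hVW`) and (F2) says `hVW = hV × hW`, then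
`cVW = cV × cW`. -/
theorem clC_prod (capX : HX →ₗ[R] GX) (capY : HY →ₗ[R] GY) (capXY : HXY →ₗ[R] GXY)
    (crossC : HX →ₗ[R] HY →ₗ[R] HXY) (crossH : GX →ₗ[R] GY →ₗ[R] GXY)
    (hcap : ∀ a b, capXY (crossC a b) = crossH (capX a) (capY b)) (hinj : Function.Injective capXY)
    {cV : HX} {cW : HY} {cVW : HXY} {hV : GX} {hW : GY} {hVW : GXY}
    (hcV : capX cV = hV) (hcW : capY cW = hW) (hcVW : capXY cVW = hVW) (hF2 : hVW = crossH hV hW) :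
    cVW = crossC cV cW := by
  apply hinj
  rw [hcVW, hF2, hcap, hcV, hcW]

/-- «The last claim follows by bilinearity of ×»: for submodules `AlgX`, `AlgY` spanned by sets `SX`, `SY` (the classes
of subvarieties) and a submodule `AlgXY` of `HXY` containing `crossC v w` for all generators `v ∈ SX`, `w ∈ SY`,
`crossC a b ∈ AlgXY` for every `a ∈ span SX`, `b ∈ span SY`. -/
theorem cross_mem_span_of_forall (crossC : HX →ₗ[R] HY →ₗ[R] HXY) {SX : Set HX} {SY : Set HY}
    (AlgXY : Submodule R HXY) (hgen : ∀ v ∈ SX, ∀ w ∈ SY, crossC v w ∈ AlgXY)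
    {a : HX} (ha : a ∈ Submodule.span R SX) {b : HY} (hb : b ∈ Submodule.span R SY) :
    crossC a b ∈ AlgXY := by
  -- first in the left variable, for a fixed generator `w`
  have hleft : ∀ w ∈ SY, crossC a w ∈ AlgXY := by
    intro w hw
    induction ha using Submodule.span_induction with
    | mem v hv => exact hgen v hv w hw
    | zero => simp only [map_zero, LinearMap.zero_apply]; exact AlgXY.zero_mem
    | add v v' _ _ hv hv' => rw [map_add, LinearMap.add_apply]; exact AlgXY.add_mem hv hv'
    | smul r v _ hv => rw [map_smul, LinearMap.smul_apply]; exact AlgXY.smul_mem r hv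
  -- then in the right variable
  induction hb using Submodule.span_induction with
  | mem w hw => exact hleft w hw
  | zero => rw [map_zero]; exact AlgXY.zero_mem
  | add w w' _ _ hw hw' => rw [map_add]; exact AlgXY.add_mem hw hw'
  | smul r w _ hw => rw [map_smul]; exact AlgXY.smul_mem r hw

/-- The span form: `a × b` lies in the span of the cross products of generators (Alg^*(X × Y) ⊇ span {v × w}). -/
theorem cross_mem_span (crossC : HX →ₗ[R] HY →ₗ[R] HXY) {SX : Set HX} {SY : Set HY}
    {a : HX} (ha : a ∈ Submodule.span R SX) {b : HY} (hb : b ∈ Submodule.span R SY) :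
    crossC a b ∈ Submodule.span R {u | ∃ v ∈ SX, ∃ w ∈ SY, crossC v w = u} :=
  cross_mem_span_of_forall crossC _ (fun v hv w hw => Submodule.subset_span (by exact ⟨v, hv, w, hw, rfl⟩)) ha hb

/-- Lemma A4.3.2 in one statement: the cohomological class of a product of subvarieties is the cross product of the
classes, hence (with `SXY ⊇ {cl^{X×Y}(V × W)}`) the cross product of two algebraic classes is algebraic. -/
theorem cross_mem_alg (capX : HX →ₗ[R] GX) (capY : HY →ₗ[R] GY) (capXY : HXY →ₗ[R] GXY)
    (crossC : HX →ₗ[R] HY →ₗ[R] HXY) (crossH : GX →ₗ[R] GY →ₗ[R] GXY)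
    (hcap : ∀ a b, capXY (crossC a b) = crossH (capX a) (capY b)) (hinj : Function.Injective capXY)
    {SX : Set HX} {SY : Set HY} {SXY : Set HXY}
    -- (F2) together with the Fulton classes: for generators `v`, `w` there is a generator `u` of `SXY` whose homology
    -- class is the homology cross product of those of `v` and `w`
    (hF2 : ∀ v ∈ SX, ∀ w ∈ SY, ∃ u ∈ SXY, capXY u = crossH (capX v) (capY w))
    {a : HX} (ha : a ∈ Submodule.span R SX) {b : HY} (hb : b ∈ Submodule.span R SY) :
    crossC a b ∈ Submodule.span R SXY := by
  refine cross_mem_span_of_forall crossC _ (fun v hv w hw => ?_) ha hb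
  obtain ⟨u, hu, hcu⟩ := hF2 v hv w hw
  have : u = crossC v w := clC_prod capX capY capXY crossC crossH hcap hinj rfl rfl hcu rfl
  rw [← this]
  exact Submodule.subset_span hu

end Summit.Ventures.HodgeRepro2.A2CrossProduct
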